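import Summits.QuantumFields.YangMills.Theorems.UnitScaleTiltProp7Lane2PlateauCutoff
import HarnessLib

/-!
# Route `UnitScaleTilt`, crux K1 «MinimiserStabilityRegPr» (stmt-QuantumFields-19200) — route-R E′ (A′), LANE II «DIVERGENCE RECOVERY AT CURVED `W`» (★★OWNER RULING №23),
# (B7) bookkeeping «THE PATCH GEOMETRY» ([I-3] of ★p1 g19 LANE II NAMER WORD №13): **block-tiled patches `Ω(C, D) := {fine objects whose (K−n)-block is within coarse cyclic
# sup-distance D of the coarse centre C}` over the EXPLICIT coarse grid `C_g κ = g_κ·L^s` (`g ∈ [0, 2L^{m+n−s})³`, corners = (B6)'s centres by ✓`corner_eq_centre`), the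
# MULTIPLICITY COUNT `#{g : Y ∈ Ω(C_g, D)} ≤ (2⌊(D + R − 1)∕R⌋ + 1)³` (`R = L^s`; `= 7³` at `D = 2R+1`, `= 5³` at `D = R+2`), and the DOUBLE-COUNTING ROW
# `Σ_g Σ_{i ∈ Ω(C_g, D)} w_i ≤ ν·Σ_i w_i` for every nonnegative weight on any finite index set positioned in the coarse torus** — the three Σ-rows of the (REC) budget
# (`Σ N_c ≤ ν‖y‖²`, `Σ Cu_c ≤ ν·CURL`, `Σ As_c ≤ ν·AVG`) are its instances at the member's bond ∕ plaquette ∕ coarse-bond weights (2026-08-29).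

Cell `ym3-torus` ∕ width seat `ym3-torus-px9` (gen 7, «width 9»).  THEOREMS ONLY (0 `def`, 0 `sorry`; patches and grid written INLINE); `--supports stmt-QuantumFields-19200 --as helper`,
count-neutral.  YM₃ on T³ is a ladder rung (R3), not d = 4, not the Clay problem; nothing here claims (B6), (B7), the divergence-recovery row (REC), `hN06`, E′, EX or the gap.

WHY.  The (REC) assembly sums per-patch budgets (✓p708710 `patch_budget` ∕ `summed_budget`) over the centres of the scale-`R` partition of unity; every summed resource row needs
«each fine bond ∕ plaquette ∕ coarse bond lies in at most `ν` patches».  ✓`exists_partitionOfUnity`∕`exists_cutoffPackage` export the centre set `Zc` existentially (their rows do not pin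
its density), so the multiplicity is proved here for the explicit grid the package is built on (`c = g·M`, `M = Rℓ`; ✓`Prop7Lane2PlateauCutoff.corner_eq_centre` identifies the two), with
patches defined through the block map `iterBlockOf (K−n)` (lit ✓`B5Eq118OneStroke`) — so that ✓`plateauCutoff_eq_one_of_block_near`∕`…_on_readSet` (S2) apply on `Ω(C, R+2)` verbatim.

WHAT IS PROVED (ns `…Theorems.Prop7Lane2PatchGeometry`):
* §1 (pure `Finset`) ★ `sum_sum_filter_le_mul_sum` — double counting: multiplicity `≤ ν` of a relation ⇒ `Σ_{c∈Z} Σ_{i∈S, c~i} w i ≤ ν·Σ_{i∈S} w i` for `w ≥ 0`.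
* §2 (one cycle `ZMod N`, `N = A·R`): `centre_sub_centre_eq` ∕ `val_centre_sub_centre` ∕ ★ `cycDist_centres_eq` (the grid distance SCALES: `dist_N(qR, aR) = R·dist_A(q, a)`),
  `cycDist_self_block_le` (`dist(Y, ⌊Y∕R⌋·R) ≤ R − 1`), ★ `cycDist_index_le_of_near` (`dist_N(Y, aR) ≤ D ⇒ dist_A(⌊Y∕R⌋, a) ≤ ⌊(D+R−1)∕R⌋`), ★ `card_filter_cycDist_le`
  (`#{a < A : dist_A(q, a) ≤ k} ≤ 2k + 1`), ★★ `card_filter_near_centre_le` (`#{a < A : dist_N(Y, aR) ≤ D} ≤ 2⌊(D+R−1)∕R⌋ + 1`).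
* §3 (the member, `R = L^s`, `A = 2L^{m+n−s}`, `N_{K−n} = A·R`): `sitesPerDir_level_eq_mul`, ★★★ `card_grid_near_le` (M1: `≤ (2⌊(D+R−1)∕R⌋+1)³`), `card_grid_near_le_outer` (`D = 2R+1`:
  `≤ 343`), `card_grid_near_le_inner` (`D = R+2`: `≤ 125`), ★★★ `sum_grid_sum_patch_le` (M2, any finite index `ι` with a position map `pos : ι → Site (F.P K) (K−n)`), and the
  three readings `sum_grid_sum_patch_le_sites` (`pos := iterBlockOf (K−n)`), `sum_grid_sum_patch_le_bonds` (`pos b := iterBlockOf (K−n) b.src`), `sum_grid_sum_patch_le_coarseBonds`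
  (`pos ĉ := ĉ.src`).
HONEST SCOPE.  Cyclic-distance ∕ `Finset` counting; nothing of the lattice gauge theory, of print, of (B6)∕(B7)∕(REC)∕`hN06`∕the crux is asserted; rung R3, not Clay; YM gap NOT proved.

References: T. Bałaban, CMP 99 (1985) 389–434 [Balaban1985BackgroundPropagators] ((3.100) pp.413–414: localisation at scale `M`, finite overlap of the cubes; (3.23) p.394);
T. Bałaban, CMP 95 (1984) 17–40 [Balaban1984PropagatorsI] ((1.6) p.18: the block lattices); [folklore] (double counting).
-/

set_option autoImplicit false

noncomputable section

open scoped BigOperators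

namespace Summit.QuantumFields.YangMills.Theorems.Prop7Lane2PatchGeometry

open Literature.MathematicalPhysics.QuantumFieldTheory.Balaban1983to89
open Literature.MathematicalPhysics.QuantumFieldTheory.Balaban1983to89.T3ContinuumYM3Torus
open B5Eq118OneStroke (iterBlockOf)
open Summit.QuantumFields.YangMills.Theorems.Prop7Lane2PlateauCutoff (cycDist_triangle)

/-! ## §1 Double counting -/

section DoubleCounting

variable {γ ι : Type*}

/-- ★ **DOUBLE COUNTING**: if every `i ∈ S` is related to at most `ν` elements of `Z`, then for every nonnegative weight `w`,
`Σ_{c ∈ Z} Σ_{i ∈ S, c ~ i} w i ≤ ν · Σ_{i ∈ S} w i`. [folklore] -/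
theorem sum_sum_filter_le_mul_sum (Z : Finset γ) (S : Finset ι) (rel : γ → ι → Prop) [∀ c i, Decidable (rel c i)] (ν : ℕ)
    (hmult : ∀ i ∈ S, (Z.filter (fun c => rel c i)).card ≤ ν) (w : ι → ℝ) (hw : ∀ i ∈ S, 0 ≤ w i) :
    ∑ c ∈ Z, ∑ i ∈ S.filter (fun i => rel c i), w i ≤ (ν : ℝ) * ∑ i ∈ S, w i := by
  have h1 : ∀ c ∈ Z, ∑ i ∈ S.filter (fun i => rel c i), w i = ∑ i ∈ S, (if rel c i then w i else 0) := fun c _ => by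
    rw [Finset.sum_filter]
  rw [Finset.sum_congr rfl h1, Finset.sum_comm, Finset.mul_sum]
  refine Finset.sum_le_sum fun i hi => ?_
  have h2 : ∑ c ∈ Z, (if rel c i then w i else 0) = ((Z.filter (fun c => rel c i)).card : ℝ) * w i := by
    rw [← Finset.sum_filter, Finset.sum_const, nsmul_eq_mul]
  rw [h2]
  exact mul_le_mul_of_nonneg_right (by exact_mod_cast hmult i hi) (hw i hi)

end DoubleCounting

/-! ## §2 One cycle `ZMod N`, `N = A·R`: the grid `a·R`, `a < A`, and how many grid points are near a given point -/

section Cycle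

variable {N A R : ℕ} [NeZero N]

/-- The difference of two grid points is the grid point of the difference of indices: `qR − aR = ((q + (A − a))·R : ℕ)` in `ZMod N`, `N = A·R`. [folklore] -/
theorem centre_sub_centre_eq (hN : N = A * R) {q a : ℕ} (ha : a < A) :
    ((q * R : ℕ) : ZMod N) - ((a * R : ℕ) : ZMod N) = (((q + (A - a)) * R : ℕ) : ZMod N) := by
  subst hN
  have e : ((q + (A - a)) * R : ℕ) = q * R + (A * R - a * R) := by rw [Nat.add_mul, Nat.sub_mul]
  rw [e, Nat.cast_add, Nat.cast_sub (Nat.mul_le_mul_right R ha.le), ZMod.natCast_self]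
  ring

omit [NeZero N] in
/-- The same on the index cycle `ZMod A`: `q − a = ((q + (A − a)) : ℕ)`. [folklore] -/
theorem index_sub_index_eq {q a : ℕ} (ha : a < A) : ((q : ZMod A) - (a : ZMod A)) = ((q + (A - a) : ℕ) : ZMod A) := by
  rw [Nat.cast_add, Nat.cast_sub ha.le, ZMod.natCast_self]
  ring

/-- The value of a grid difference: `(qR − aR).val = (q − a : ZMod A).val · R`. [folklore] -/
theorem val_centre_sub_centre (hN : N = A * R) {q a : ℕ} (ha : a < A) :
    (((q * R : ℕ) : ZMod N) - ((a * R : ℕ) : ZMod N)).val = ((q : ZMod A) - (a : ZMod A)).val * R := by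
  rw [centre_sub_centre_eq hN ha, index_sub_index_eq ha, ZMod.val_natCast, ZMod.val_natCast]
  subst hN
  exact Nat.mul_mod_mul_right _ _ _

/-- ★ **THE GRID DISTANCE SCALES**: `dist_N(qR, aR) = R · dist_A(q, a)` for `q, a < A`. [folklore] -/
theorem cycDist_centres_eq (hN : N = A * R) {q a : ℕ} (hq : q < A) (ha : a < A) :
    min (((q * R : ℕ) : ZMod N) - ((a * R : ℕ) : ZMod N)).val (((a * R : ℕ) : ZMod N) - ((q * R : ℕ) : ZMod N)).val
      = R * min ((q : ZMod A) - (a : ZMod A)).val ((a : ZMod A) - (q : ZMod A)).val := by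
  rw [val_centre_sub_centre hN ha, val_centre_sub_centre hN hq]
  rcases le_total ((q : ZMod A) - (a : ZMod A)).val ((a : ZMod A) - (q : ZMod A)).val with h | h
  · rw [min_eq_left h, min_eq_left (Nat.mul_le_mul_right R h), mul_comm]
  · rw [min_eq_right h, min_eq_right (Nat.mul_le_mul_right R h), mul_comm]

/-- A point is within `R − 1` of the grid point of its own block: `dist(Y, ⌊Y∕R⌋·R) ≤ R − 1` (`R ≥ 1`). [folklore] -/
theorem cycDist_self_block_le (hR : 0 < R) (Y : ZMod N) :
    min (Y - ((Y.val / R * R : ℕ) : ZMod N)).val ((((Y.val / R * R : ℕ) : ZMod N)) - Y).val ≤ R - 1 := by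
  refine (min_le_left _ _).trans ?_
  set q := Y.val / R with hq
  have hqr : R * q + Y.val % R = Y.val := Nat.div_add_mod Y.val R
  have hcomm : q * R = R * q := mul_comm _ _
  have hle : q * R ≤ Y.val := by omega
  have hlt : q * R < N := lt_of_le_of_lt hle (ZMod.val_lt Y)
  have hval : (((q * R : ℕ) : ZMod N)).val = q * R := ZMod.val_cast_of_lt hlt
  rw [ZMod.val_sub (by rw [hval]; exact hle), hval]
  have hmod : Y.val % R < R := Nat.mod_lt _ hR
  omega

/-- The block index of a point is below `A` (`N = A·R`, `R ≥ 1`). [folklore] -/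
theorem div_lt_A (hN : N = A * R) (hR : 0 < R) (Y : ZMod N) : Y.val / R < A := by
  rw [Nat.div_lt_iff_lt_mul hR]
  have := ZMod.val_lt Y
  subst hN
  exact this

/-- ★ **NEAR A GRID POINT ⇒ NEAR IN INDEX**: `dist_N(Y, aR) ≤ D ⇒ dist_A(⌊Y∕R⌋, a) ≤ ⌊(D + R − 1)∕R⌋` (triangle inequality through `⌊Y∕R⌋·R` and the scaling). [folklore] -/
theorem cycDist_index_le_of_near (hN : N = A * R) (hR : 0 < R) (Y : ZMod N) {a : ℕ} (ha : a < A) {D : ℕ}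
    (h : min (Y - ((a * R : ℕ) : ZMod N)).val ((((a * R : ℕ) : ZMod N)) - Y).val ≤ D) :
    min (((Y.val / R : ℕ) : ZMod A) - (a : ZMod A)).val ((a : ZMod A) - ((Y.val / R : ℕ) : ZMod A)).val ≤ (D + R - 1) / R := by
  have hq := div_lt_A hN hR Y
  have hscale := cycDist_centres_eq hN hq ha
  have h1 := cycDist_self_block_le (N := N) hR Y
  have htri := cycDist_triangle (((Y.val / R * R : ℕ) : ZMod N)) Y (((a * R : ℕ) : ZMod N))
  rw [min_comm] at h1
  rw [Nat.le_div_iff_mul_le hR, mul_comm, ← hscale]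
  have hR1 : R - 1 + 1 = R := Nat.sub_add_cancel hR
  omega

omit [NeZero N] in
/-- ★ **AT MOST `2k + 1` INDICES WITHIN CYCLIC DISTANCE `k`**: `#{a < A : dist_A(q, a) ≤ k} ≤ 2k + 1`. [folklore] -/
theorem card_filter_cycDist_le [NeZero A] (q : ZMod A) (k : ℕ) :
    ((Finset.range A).filter (fun a : ℕ => min (q - (a : ZMod A)).val ((a : ZMod A) - q).val ≤ k)).card ≤ 2 * k + 1 := by
  classical
  set T : Finset (ZMod A) := (Finset.Icc (-(k : ℤ)) (k : ℤ)).image (fun j : ℤ => q + (j : ZMod A)) with hT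
  have hTcard : T.card ≤ 2 * k + 1 := by
    refine (Finset.card_image_le).trans ?_
    rw [Int.card_Icc]
    omega
  refine le_trans ?_ hTcard
  refine Finset.card_le_card_of_injOn (fun a : ℕ => (a : ZMod A)) (fun a ha => ?_) ?_
  · rw [Finset.mem_coe, Finset.mem_filter] at ha
    obtain ⟨_, hk⟩ := ha
    rw [hT, Finset.mem_coe, Finset.mem_image]
    rcases min_le_iff.mp hk with h | h
    · refine ⟨-((q - (a : ZMod A)).val : ℤ), Finset.mem_Icc.mpr ⟨by omega, by omega⟩, ?_⟩
      rw [Int.cast_neg, Int.cast_natCast, ZMod.natCast_zmod_val]; ring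
    · refine ⟨(((a : ZMod A) - q).val : ℤ), Finset.mem_Icc.mpr ⟨by omega, by omega⟩, ?_⟩
      rw [Int.cast_natCast, ZMod.natCast_zmod_val]; ring
  · intro a ha b hb hab
    rw [Finset.mem_coe, Finset.mem_filter, Finset.mem_range] at ha hb
    have := congrArg ZMod.val hab
    rwa [ZMod.val_cast_of_lt ha.1, ZMod.val_cast_of_lt hb.1] at this

/-- ★★ **AT MOST `2⌊(D+R−1)∕R⌋ + 1` GRID POINTS WITHIN DISTANCE `D`** of any point of the cycle (`N = A·R`, `A, R ≥ 1`).
[cite: Balaban1985BackgroundPropagators, (3.100) p.414 (finite overlap)] -/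
theorem card_filter_near_centre_le (hN : N = A * R) (hA : 0 < A) (hR : 0 < R) (Y : ZMod N) (D : ℕ) :
    ((Finset.range A).filter (fun a : ℕ => min (Y - ((a * R : ℕ) : ZMod N)).val ((((a * R : ℕ) : ZMod N)) - Y).val ≤ D)).card
      ≤ 2 * ((D + R - 1) / R) + 1 := by
  haveI : NeZero A := ⟨hA.ne'⟩
  refine le_trans (Finset.card_le_card fun a ha => ?_) (card_filter_cycDist_le (((Y.val / R : ℕ) : ZMod A)) ((D + R - 1) / R))
  rw [Finset.mem_filter] at ha ⊢
  exact ⟨ha.1, cycDist_index_le_of_near hN hR Y (Finset.mem_range.mp ha.1) ha.2⟩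

end Cycle

/-! ## §3 The member: the coarse grid `C_g = g·L^s`, block-tiled patches `Ω(C, D)`, multiplicity (M1) and the double-counting row (M2) -/

section Member

variable (F : T3Family) (n K s : ℕ)

/-- The coarse lattice of the member has `A·R = 2L^{m+n−s}·L^s` sites per direction (`n ≤ K`, `s ≤ m + n`). [folklore] -/
theorem sitesPerDir_level_eq_mul (hnK : n ≤ K) (hs : s ≤ F.m + n) :
    (F.P K).sitesPerDir (K - n) = (2 * F.L ^ (F.m + n - s)) * F.L ^ s := by
  show 2 * F.L ^ (F.m + K - (K - n)) = _
  rw [mul_assoc, ← pow_add]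
  congr 2
  omega

/-- ★★★ **(M1) MULTIPLICITY OF THE BLOCK-TILED PATCHES**: for every coarse site `Y` and radius `D` (in blocks), the number of grid indices `g ∈ [0, 2L^{m+n−s})³` whose centre
`C_g κ = g_κ·L^s` is within coarse cyclic sup-distance `D` of `Y` is at most `(2⌊(D + L^s − 1)∕L^s⌋ + 1)³`. [cite: Balaban1985BackgroundPropagators, (3.100) p.414] -/
theorem card_grid_near_le (hnK : n ≤ K) (hs : s ≤ F.m + n) (D : ℕ) (Y : Site (F.P K) (K - n)) :
    ((Fintype.piFinset fun _ : Fin 3 => Finset.range (2 * F.L ^ (F.m + n - s))).filter (fun g : Fin 3 → ℕ =>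
        ∀ κ : Fin 3, min (Y κ - ((g κ * F.L ^ s : ℕ) : ZMod ((F.P K).sitesPerDir (K - n)))).val
          ((((g κ * F.L ^ s : ℕ) : ZMod ((F.P K).sitesPerDir (K - n)))) - Y κ).val ≤ D)).card
      ≤ (2 * ((D + F.L ^ s - 1) / F.L ^ s) + 1) ^ 3 := by
  classical
  have hL : 0 < F.L := by have := F.hL.2; omega
  have hA : 0 < 2 * F.L ^ (F.m + n - s) := by positivity
  have hR : 0 < F.L ^ s := pow_pos hL _
  have hN := sitesPerDir_level_eq_mul F n K s hnK hs
  haveI : NeZero ((F.P K).sitesPerDir (K - n)) := ⟨by rw [hN]; positivity⟩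
  -- the filter sits inside the product of the per-coordinate filters
  refine le_trans (Finset.card_le_card (fun g hg => ?_))
    (le_of_eq_of_le (Fintype.card_piFinset fun κ : Fin 3 => (Finset.range (2 * F.L ^ (F.m + n - s))).filter (fun a : ℕ =>
      min (Y κ - ((a * F.L ^ s : ℕ) : ZMod ((F.P K).sitesPerDir (K - n)))).val
        ((((a * F.L ^ s : ℕ) : ZMod ((F.P K).sitesPerDir (K - n)))) - Y κ).val ≤ D)) ?_)
  · rw [Finset.mem_filter, Fintype.mem_piFinset] at hg
    rw [Fintype.mem_piFinset]
    intro κ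
    exact Finset.mem_filter.mpr ⟨hg.1 κ, hg.2 κ⟩
  · calc ∏ κ : Fin 3, ((Finset.range (2 * F.L ^ (F.m + n - s))).filter (fun a : ℕ =>
            min (Y κ - ((a * F.L ^ s : ℕ) : ZMod ((F.P K).sitesPerDir (K - n)))).val
              ((((a * F.L ^ s : ℕ) : ZMod ((F.P K).sitesPerDir (K - n)))) - Y κ).val ≤ D)).card
        ≤ ∏ _κ : Fin 3, (2 * ((D + F.L ^ s - 1) / F.L ^ s) + 1) :=
          Finset.prod_le_prod' fun κ _ => card_filter_near_centre_le hN hA hR (Y κ) D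
      _ = (2 * ((D + F.L ^ s - 1) / F.L ^ s) + 1) ^ 3 := by rw [Finset.prod_const, Finset.card_univ, Fintype.card_fin]

/-- (M1) at the OUTER radius `D = 2R + 1` (`R = L^s`): multiplicity `≤ 7³ = 343`. -/
theorem card_grid_near_le_outer (hnK : n ≤ K) (hs : s ≤ F.m + n) (Y : Site (F.P K) (K - n)) :
    ((Fintype.piFinset fun _ : Fin 3 => Finset.range (2 * F.L ^ (F.m + n - s))).filter (fun g : Fin 3 → ℕ =>
        ∀ κ : Fin 3, min (Y κ - ((g κ * F.L ^ s : ℕ) : ZMod ((F.P K).sitesPerDir (K - n)))).val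
          ((((g κ * F.L ^ s : ℕ) : ZMod ((F.P K).sitesPerDir (K - n)))) - Y κ).val ≤ 2 * F.L ^ s + 1)).card ≤ 343 := by
  have hL : 0 < F.L := by have := F.hL.2; omega
  have hR : 1 ≤ F.L ^ s := Nat.one_le_pow _ _ hL
  refine (card_grid_near_le F n K s hnK hs _ Y).trans ?_
  have h : (2 * F.L ^ s + 1 + F.L ^ s - 1) / F.L ^ s = 3 := by
    have e : 2 * F.L ^ s + 1 + F.L ^ s - 1 = 3 * F.L ^ s := by omega
    rw [e, Nat.mul_div_cancel _ (by omega)]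
  rw [h]; norm_num

/-- (M1) at the INNER radius `D = R + 2` (`R = L^s ≥ 2`): multiplicity `≤ 5³ = 125`. -/
theorem card_grid_near_le_inner (hnK : n ≤ K) (hs : s ≤ F.m + n) (hR2 : 2 ≤ F.L ^ s) (Y : Site (F.P K) (K - n)) :
    ((Fintype.piFinset fun _ : Fin 3 => Finset.range (2 * F.L ^ (F.m + n - s))).filter (fun g : Fin 3 → ℕ =>
        ∀ κ : Fin 3, min (Y κ - ((g κ * F.L ^ s : ℕ) : ZMod ((F.P K).sitesPerDir (K - n)))).val
          ((((g κ * F.L ^ s : ℕ) : ZMod ((F.P K).sitesPerDir (K - n)))) - Y κ).val ≤ F.L ^ s + 2)).card ≤ 125 := by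
  refine (card_grid_near_le F n K s hnK hs _ Y).trans ?_
  have h : (F.L ^ s + 2 + F.L ^ s - 1) / F.L ^ s = 2 := by
    have e : F.L ^ s + 2 + F.L ^ s - 1 = 1 + 2 * F.L ^ s := by omega
    rw [e, Nat.add_mul_div_right _ _ (by omega), Nat.div_eq_of_lt (by omega)]
  rw [h]; norm_num

/-- ★★★ **(M2) THE DOUBLE-COUNTING ROW OF THE PATCHES**: for any finite index set `ι` of «fine objects» with a position map `pos : ι → Site (F.P K) (K − n)` (the `(K−n)`-block of a fine
site ∕ of a bond's source ∕ a coarse bond's source) and any nonnegative weight `w`, the patch sums over the grid count every object at most `ν = (2⌊(D+R−1)∕R⌋+1)³` times: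
`Σ_g Σ_{i : pos i ∈ ball(C_g, D)} w i ≤ ν·Σ_i w i`. [cite: Balaban1985BackgroundPropagators, (3.100) p.414] -/
theorem sum_grid_sum_patch_le (hnK : n ≤ K) (hs : s ≤ F.m + n) (D : ℕ) {ι : Type*} [Fintype ι] (pos : ι → Site (F.P K) (K - n))
    (w : ι → ℝ) (hw : ∀ i, 0 ≤ w i) :
    ∑ g ∈ (Fintype.piFinset fun _ : Fin 3 => Finset.range (2 * F.L ^ (F.m + n - s))),
        ∑ i ∈ Finset.univ.filter (fun i : ι => ∀ κ : Fin 3, min (pos i κ - ((g κ * F.L ^ s : ℕ) : ZMod ((F.P K).sitesPerDir (K - n)))).val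
          ((((g κ * F.L ^ s : ℕ) : ZMod ((F.P K).sitesPerDir (K - n)))) - pos i κ).val ≤ D), w i
      ≤ ((2 * ((D + F.L ^ s - 1) / F.L ^ s) + 1) ^ 3 : ℕ) * ∑ i, w i := by
  classical
  exact sum_sum_filter_le_mul_sum _ _ _ _ (fun i _ => card_grid_near_le F n K s hnK hs D (pos i)) w fun i _ => hw i

/-- (M2) read on FINE SITES (`pos := iterBlockOf (K−n)`; e.g. site masses `Σ_x ‖φ x‖²`). -/
theorem sum_grid_sum_patch_le_sites (hnK : n ≤ K) (hs : s ≤ F.m + n) (D : ℕ) (w : Site (F.P K) 0 → ℝ) (hw : ∀ x, 0 ≤ w x) :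
    ∑ g ∈ (Fintype.piFinset fun _ : Fin 3 => Finset.range (2 * F.L ^ (F.m + n - s))),
        ∑ x ∈ Finset.univ.filter (fun x : Site (F.P K) 0 => ∀ κ : Fin 3,
          min ((iterBlockOf (K - n) x) κ - ((g κ * F.L ^ s : ℕ) : ZMod ((F.P K).sitesPerDir (K - n)))).val
            ((((g κ * F.L ^ s : ℕ) : ZMod ((F.P K).sitesPerDir (K - n)))) - (iterBlockOf (K - n) x) κ).val ≤ D), w x
      ≤ ((2 * ((D + F.L ^ s - 1) / F.L ^ s) + 1) ^ 3 : ℕ) * ∑ x, w x :=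
  by
  classical
  exact sum_sum_filter_le_mul_sum _ _ _ _ (fun x _ => card_grid_near_le F n K s hnK hs D (iterBlockOf (K - n) x)) w fun x _ => hw x

/-- (M2) read on FINE BONDS through the block of the source (`pos b := iterBlockOf (K−n) b.src`; e.g. `N_c = c₀·Σ_{b ∈ Ω_c}‖y b‖²`, the plaquette∕curl weights by base bond). -/
theorem sum_grid_sum_patch_le_bonds (hnK : n ≤ K) (hs : s ≤ F.m + n) (D : ℕ) (w : PBond (F.P K) 0 → ℝ) (hw : ∀ b, 0 ≤ w b) :
    ∑ g ∈ (Fintype.piFinset fun _ : Fin 3 => Finset.range (2 * F.L ^ (F.m + n - s))),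
        ∑ b ∈ Finset.univ.filter (fun b : PBond (F.P K) 0 => ∀ κ : Fin 3,
          min ((iterBlockOf (K - n) b.src) κ - ((g κ * F.L ^ s : ℕ) : ZMod ((F.P K).sitesPerDir (K - n)))).val
            ((((g κ * F.L ^ s : ℕ) : ZMod ((F.P K).sitesPerDir (K - n)))) - (iterBlockOf (K - n) b.src) κ).val ≤ D), w b
      ≤ ((2 * ((D + F.L ^ s - 1) / F.L ^ s) + 1) ^ 3 : ℕ) * ∑ b, w b :=
  by
  classical
  exact sum_sum_filter_le_mul_sum _ _ _ _ (fun b _ => card_grid_near_le F n K s hnK hs D (iterBlockOf (K - n) b.src)) w fun b _ => hw b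

/-- (M2) read on COARSE BONDS (`pos ĉ := ĉ.src`; e.g. `As_c = Σ_{ĉ ∈ Ω_c′} ‖Q_k y (ĉ)‖²`). -/
theorem sum_grid_sum_patch_le_coarseBonds (hnK : n ≤ K) (hs : s ≤ F.m + n) (D : ℕ) (w : PBond (F.P K) (K - n) → ℝ) (hw : ∀ c, 0 ≤ w c) :
    ∑ g ∈ (Fintype.piFinset fun _ : Fin 3 => Finset.range (2 * F.L ^ (F.m + n - s))),
        ∑ c ∈ Finset.univ.filter (fun c : PBond (F.P K) (K - n) => ∀ κ : Fin 3,
          min (c.src κ - ((g κ * F.L ^ s : ℕ) : ZMod ((F.P K).sitesPerDir (K - n)))).val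
            ((((g κ * F.L ^ s : ℕ) : ZMod ((F.P K).sitesPerDir (K - n)))) - c.src κ).val ≤ D), w c
      ≤ ((2 * ((D + F.L ^ s - 1) / F.L ^ s) + 1) ^ 3 : ℕ) * ∑ c, w c :=
  by
  classical
  exact sum_sum_filter_le_mul_sum _ _ _ _ (fun c _ => card_grid_near_le F n K s hnK hs D c.src) w fun c _ => hw c

end Member

end Summit.QuantumFields.YangMills.Theorems.Prop7Lane2PatchGeometry

end
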